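import Literature.MathematicalPhysics.QuantumLattice.HubbardMatsubaraShellRowSum
import HarnessLib

/-!
# The coincident-point entry (tadpole) of the Matsubara shell covariance is `O(β/M)`

Topic `MathematicalPhysics/QuantumLattice`; companion of `HubbardMatsubaraShellGram` (entry bound `κ_S² = O(1)` of the pulled-back shell covariance
from the Gram form) and `HubbardMatsubaraShellRowSum`.  At COINCIDENT position–time points the `(+,−)` entry of `S(x,τ)ᵀ·S·S(x,τ)` is the
reflection-symmetric shell sum `(βL²)⁻¹ Σ_{k⃗} Σ_{n ∈ shell} 1/(−iω_n + e_K(k⃗))`, in which the `±ω` pairs cancel to `2e/(ν²+e²)`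
(`HubbardMatsubaraShellSums.norm_sum_shell_one_div_le`): the Hartree shift carried by the shell frequencies — what the first cumulant
`e^{Δ_S}V − V` of the shell integration reads — is `≤ c_e·β/(2π²M)`, `c_e = 4 + |μ| + coeffNorm 0 K`, not merely `κ_S²`.

* `gridSub_hubbardCovShellCT_apply_self` — the closed form below the shell floor; **`norm_gridSub_hubbardCovShellCT_apply_self_le`**.

Everything is proved; no definitions, no named facts.

## Sources

G. Benfatto, A. Giuliani, V. Mastropietro, Ann. Henri Poincaré 7 (2006) 809–898, §2.1 (2.3)–(2.6) and §2.2 (2.14) (the tadpole of the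
ultraviolet integration) [`BenfattoGiulianiMastropietro2006`]; W. de S. Pedra, M. Salmhofer, Commun. Math. Phys. 282 (2008) 797–818, §5
[`PedraSalmhofer2008`].  The `[cite: …]` tags LOCATE the construct each statement is about; the statements are elementary.
-/

noncomputable section

namespace Literature.MathematicalPhysics.QuantumLattice

open Finset Complex Literature.Probability.LatticeModels

variable {L : ℕ} [NeZero L] {M M'' : ℕ} {P : Type*}

/-- **The coincident-point `(+,−)` entry of the pulled-back shell covariance, below the shell floor**:
`(SᵀSS)((a,σ,+),(a,σ,−)) = (βL²)⁻¹ Σ_{k⃗} Σ_{n ∈ shell} 1/(−iω_n + e_K(k⃗))`. [cite: BenfattoGiulianiMastropietro2006, §2.2 (2.14)] -/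
theorem gridSub_hubbardCovShellCT_apply_self {β : ℝ} (hβ : 0 < β) (h : M ≤ M'') (μ : ℝ) (K : TrigPolyC4v) {Λ : ℝ} (hΛ : 0 < Λ)
    (hΛle : Λ ≤ Real.pi * (2 * M + 1) / β) (x : P → TorusSite 2 L) (τ : P → ℝ) (a : P) (σ : Fin 2) :
    ((gridSubMatrix L M'' β x τ).transpose * hubbardCovShellCT L h β μ 0 K Λ * gridSubMatrix L M'' β x τ) ((a, σ), 0) ((a, σ), 1) =
      ((1 / (β * (L : ℝ) ^ 2) : ℝ) : ℂ) *
        ∑ kv : TorusSite 2 L, ∑ j ∈ MatsubaraIdx.shell h, 1 / (-I * matsubaraFreq β M'' j + nambuXiCT L μ K kv) := by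
  classical
  have hβL : (β * (L : ℝ) ^ 2) ≠ 0 := by
    have hL : (0 : ℝ) < L := by exact_mod_cast Nat.pos_of_ne_zero (NeZero.ne L)
    positivity
  rw [hubbardCovShellCT_zero_seed, gridSub_pullback_normalCovariance_apply_zero_one, if_pos rfl]
  simp only [sub_self, Complex.ofReal_zero, zero_mul, Complex.exp_zero, one_mul]
  rw [Fintype.sum_prod_type, sum_comm, mul_sum]
  refine sum_congr rfl fun kv _ => ?_
  have hpt : ∀ j : MatsubaraIdx M'', ((1 / (β * (L : ℝ) ^ 2) : ℝ) : ℂ) ^ 2 * shellSymbolCT L h β μ K Λ ((j, kv), σ) =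
      if j ∈ MatsubaraIdx.shell h then ((1 / (β * (L : ℝ) ^ 2) : ℝ) : ℂ) * (1 / (-I * matsubaraFreq β M'' j + nambuXiCT L μ K kv)) else 0 := by
    intro j
    split_ifs with hj
    · rw [shellSymbolCT_eq_of_floor hβ h μ K hΛ hΛle ((j, kv), σ) hj]
      dsimp only
      rw [← mul_assoc]
      congr 1
      push_cast
      field_simp
    · rw [shellSymbolCT_of_not_mem h β μ K Λ (ks := ((j, kv), σ)) hj, mul_zero]
  simp_rw [hpt]
  rw [Finset.sum_ite_mem, Finset.univ_inter, mul_sum]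

/-- **The shell tadpole is `O(β/M)`**: `‖(SᵀSS)((a,σ,+),(a,σ,−))‖ ≤ (4 + |μ| + coeffNorm 0 K)·β/(2π²M)` below the shell floor
(`0 < β`, `1 ≤ M ≤ M″`, `0 < Λ ≤ π(2M+1)/β`; any grid; uniform in `M″`, `L`). [cite: BenfattoGiulianiMastropietro2006, §2.2 (2.14)] -/
theorem norm_gridSub_hubbardCovShellCT_apply_self_le {β : ℝ} (hβ : 0 < β) (hM : 1 ≤ M) (h : M ≤ M'') (μ : ℝ) (K : TrigPolyC4v)
    {Λ : ℝ} (hΛ : 0 < Λ) (hΛle : Λ ≤ Real.pi * (2 * M + 1) / β) (x : P → TorusSite 2 L) (τ : P → ℝ) (a : P) (σ : Fin 2) :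
    ‖((gridSubMatrix L M'' β x τ).transpose * hubbardCovShellCT L h β μ 0 K Λ * gridSubMatrix L M'' β x τ) ((a, σ), 0) ((a, σ), 1)‖ ≤
      (4 + |μ| + K.coeffNorm 0) * β / (2 * Real.pi ^ 2 * M) := by
  have hL : (0 : ℝ) < L := by exact_mod_cast Nat.pos_of_ne_zero (NeZero.ne L)
  rw [gridSub_hubbardCovShellCT_apply_self hβ h μ K hΛ hΛle x τ a σ, norm_mul, Complex.norm_real, Real.norm_of_nonneg (by positivity)]
  have hsum : ‖∑ kv : TorusSite 2 L, ∑ j ∈ MatsubaraIdx.shell h, 1 / (-I * (matsubaraFreq β M'' j : ℂ) + nambuXiCT L μ K kv)‖ ≤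
      (L : ℝ) ^ 2 * ((4 + |μ| + K.coeffNorm 0) * (β ^ 2 / (2 * Real.pi ^ 2 * M))) := by
    calc _ ≤ ∑ kv : TorusSite 2 L, ‖∑ j ∈ MatsubaraIdx.shell h, 1 / (-I * (matsubaraFreq β M'' j : ℂ) + nambuXiCT L μ K kv)‖ := norm_sum_le _ _
      _ ≤ ∑ kv : TorusSite 2 L, (4 + |μ| + K.coeffNorm 0) * (β ^ 2 / (2 * Real.pi ^ 2 * M)) := by
          refine sum_le_sum fun kv _ => (norm_sum_shell_one_div_le hβ hM h _).trans ?_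
          exact mul_le_mul_of_nonneg_right (abs_nambuXiCT_le μ K kv) (by positivity)
      _ = _ := by
          rw [sum_const, card_univ, nsmul_eq_mul]
          simp [Fintype.card_pi, ZMod.card]
  refine (mul_le_mul_of_nonneg_left hsum (by positivity)).trans (le_of_eq ?_)
  field_simp

/-- The `(−,+)` coincident entry is minus the `(+,−)` one (antisymmetry), hence obeys the same bound. [cite: BenfattoGiulianiMastropietro2006, §2.2 (2.14)] -/
theorem norm_gridSub_hubbardCovShellCT_apply_self_le' {β : ℝ} (hβ : 0 < β) (hM : 1 ≤ M) (h : M ≤ M'') (μ : ℝ) (K : TrigPolyC4v)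
    {Λ : ℝ} (hΛ : 0 < Λ) (hΛle : Λ ≤ Real.pi * (2 * M + 1) / β) (x : P → TorusSite 2 L) (τ : P → ℝ) (a : P) (σ : Fin 2) :
    ‖((gridSubMatrix L M'' β x τ).transpose * hubbardCovShellCT L h β μ 0 K Λ * gridSubMatrix L M'' β x τ) ((a, σ), 1) ((a, σ), 0)‖ ≤
      (4 + |μ| + K.coeffNorm 0) * β / (2 * Real.pi ^ 2 * M) := by
  rw [hubbardCovShellCT_zero_seed, gridSub_pullback_normalCovariance_apply_one_zero, norm_neg, ← hubbardCovShellCT_zero_seed]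
  exact norm_gridSub_hubbardCovShellCT_apply_self_le hβ hM h μ K hΛ hΛle x τ a σ


/-! ### Equal-time entries (appended): every Wick self-contraction of a LOCAL-IN-TIME interaction reads an equal-time entry -/

/-- **Equal-time `(+,−)` entries of the pulled-back shell covariance are `O(β/M)`**: for legs at grid points with the SAME time
(`τ a = τ b`; any positions, equal spins), below the shell floor,
`‖(SᵀSS)((a,σ,+),(b,σ,−))‖ ≤ (4 + |μ| + coeffNorm 0 K)·β/(2π²M)` — the time phase cancels, so the reflection-symmetric shell sum
survives the momentum sum; this is the entry every self-contraction of the (time-local) Hubbard vertex and counterterm reads in `e^{Δ_S}V − V`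
(the generic sup entry of the shell is `O(1)` one grid step apart: Gibbs). [cite: BenfattoGiulianiMastropietro2006, §2.2 (2.14)] -/
theorem norm_gridSub_hubbardCovShellCT_apply_equalTime_le {β : ℝ} (hβ : 0 < β) (hM : 1 ≤ M) (h : M ≤ M'') (μ : ℝ) (K : TrigPolyC4v)
    {Λ : ℝ} (hΛ : 0 < Λ) (hΛle : Λ ≤ Real.pi * (2 * M + 1) / β) (x : P → TorusSite 2 L) (τ : P → ℝ) {a b : P} (hab : τ a = τ b)
    (σ : Fin 2) :
    ‖((gridSubMatrix L M'' β x τ).transpose * hubbardCovShellCT L h β μ 0 K Λ * gridSubMatrix L M'' β x τ) ((a, σ), 0) ((b, σ), 1)‖ ≤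
      (4 + |μ| + K.coeffNorm 0) * β / (2 * Real.pi ^ 2 * M) := by
  classical
  have hL : (0 : ℝ) < L := by exact_mod_cast Nat.pos_of_ne_zero (NeZero.ne L)
  -- the spatial phase of momentum `k⃗` between the two points
  set φ : TorusSite 2 L → ℝ := fun kv => ∑ i, latticeMomentum L kv i * (((x a i).val : ℝ) - ((x b i).val : ℝ)) with hφ
  have hphase : ∀ k : FreqMomentum L M'', vertexPhase L M'' β k (x a) (τ a) - vertexPhase L M'' β k (x b) (τ b) = φ k.2 := by
    intro k
    simp only [vertexPhase, hab, hφ, mul_sub, Finset.sum_sub_distrib]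
    ring
  rw [hubbardCovShellCT_zero_seed, gridSub_pullback_normalCovariance_apply_zero_one, if_pos rfl]
  simp_rw [hphase]
  -- regroup: `Σ_k = Σ_{k⃗} c² e^{iφ(k⃗)} Σ_j p((j,k⃗),σ)`, and the inner sum is `βL² Σ_shell 1/(−iω+e)`
  have hinner : ∀ kv : TorusSite 2 L, ∑ j : MatsubaraIdx M'', shellSymbolCT L h β μ K Λ ((j, kv), σ) =
      ((β * (L : ℝ) ^ 2 : ℝ) : ℂ) * ∑ j ∈ MatsubaraIdx.shell h, 1 / (-I * matsubaraFreq β M'' j + nambuXiCT L μ K kv) := by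
    intro kv
    have hpt : ∀ j : MatsubaraIdx M'', shellSymbolCT L h β μ K Λ ((j, kv), σ) =
        if j ∈ MatsubaraIdx.shell h then ((β * (L : ℝ) ^ 2 : ℝ) : ℂ) * (1 / (-I * matsubaraFreq β M'' j + nambuXiCT L μ K kv)) else 0 := by
      intro j
      split_ifs with hj
      · exact shellSymbolCT_eq_of_floor hβ h μ K hΛ hΛle ((j, kv), σ) hj
      · exact shellSymbolCT_of_not_mem h β μ K Λ (ks := ((j, kv), σ)) hj
    simp_rw [hpt]
    rw [Finset.sum_ite_mem, Finset.univ_inter, mul_sum]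
  rw [Fintype.sum_prod_type, sum_comm]
  have hkv : ∀ kv : TorusSite 2 L, ∑ j : MatsubaraIdx M'', ((1 / (β * (L : ℝ) ^ 2) : ℝ) : ℂ) ^ 2 *
      (Complex.exp (((φ kv : ℝ) : ℂ) * Complex.I) * shellSymbolCT L h β μ K Λ ((j, kv), σ)) =
      ((1 / (β * (L : ℝ) ^ 2) : ℝ) : ℂ) ^ 2 * Complex.exp (((φ kv : ℝ) : ℂ) * Complex.I) *
        (((β * (L : ℝ) ^ 2 : ℝ) : ℂ) * ∑ j ∈ MatsubaraIdx.shell h, 1 / (-I * matsubaraFreq β M'' j + nambuXiCT L μ K kv)) := by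
    intro kv
    rw [← hinner kv, mul_sum]
    exact sum_congr rfl fun j _ => by ring
  simp_rw [hkv]
  have hpt : ∀ kv : TorusSite 2 L, ‖((1 / (β * (L : ℝ) ^ 2) : ℝ) : ℂ) ^ 2 * Complex.exp (((φ kv : ℝ) : ℂ) * Complex.I) *
      (((β * (L : ℝ) ^ 2 : ℝ) : ℂ) * ∑ j ∈ MatsubaraIdx.shell h, 1 / (-I * matsubaraFreq β M'' j + nambuXiCT L μ K kv))‖ ≤
      (1 / (β * (L : ℝ) ^ 2)) ^ 2 * ((β * (L : ℝ) ^ 2) * ((4 + |μ| + K.coeffNorm 0) * (β ^ 2 / (2 * Real.pi ^ 2 * M)))) := by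
    intro kv
    rw [norm_mul, norm_mul, norm_mul, norm_pow, Complex.norm_real, Real.norm_eq_abs, sq_abs, Complex.norm_exp_ofReal_mul_I, mul_one,
      Complex.norm_real, Real.norm_of_nonneg (by positivity)]
    refine mul_le_mul_of_nonneg_left (mul_le_mul_of_nonneg_left ?_ (by positivity)) (by positivity)
    exact (norm_sum_shell_one_div_le hβ hM h _).trans (mul_le_mul_of_nonneg_right (abs_nambuXiCT_le μ K kv) (by positivity))
  refine (norm_sum_le _ _).trans ((sum_le_sum fun kv _ => hpt kv).trans (le_of_eq ?_))
  rw [sum_const, card_univ, nsmul_eq_mul]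
  simp only [Fintype.card_pi, ZMod.card, prod_const, Finset.card_univ, Fintype.card_fin]
  push_cast
  field_simp

/-- The equal-time `(−,+)` entries (antisymmetry). [cite: BenfattoGiulianiMastropietro2006, §2.2 (2.14)] -/
theorem norm_gridSub_hubbardCovShellCT_apply_equalTime_le' {β : ℝ} (hβ : 0 < β) (hM : 1 ≤ M) (h : M ≤ M'') (μ : ℝ) (K : TrigPolyC4v)
    {Λ : ℝ} (hΛ : 0 < Λ) (hΛle : Λ ≤ Real.pi * (2 * M + 1) / β) (x : P → TorusSite 2 L) (τ : P → ℝ) {a b : P} (hab : τ a = τ b)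
    (σ : Fin 2) :
    ‖((gridSubMatrix L M'' β x τ).transpose * hubbardCovShellCT L h β μ 0 K Λ * gridSubMatrix L M'' β x τ) ((a, σ), 1) ((b, σ), 0)‖ ≤
      (4 + |μ| + K.coeffNorm 0) * β / (2 * Real.pi ^ 2 * M) := by
  rw [hubbardCovShellCT_zero_seed, gridSub_pullback_normalCovariance_apply_one_zero, norm_neg, ← hubbardCovShellCT_zero_seed]
  exact norm_gridSub_hubbardCovShellCT_apply_equalTime_le hβ hM h μ K hΛ hΛle x τ hab.symm σ

end Literature.MathematicalPhysics.QuantumLattice
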